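import Mathlib
import Literature.RingTheory.Binomial.BinomialSeriesRootDenominators
import Literature.RingTheory.PowerSeries.DenominatorTypeInversion
import HarnessLib

/-!
# The denominator type of `x(t)` when `x(t)^N ∈ ℤ⟦t⟧` (CDT §2.1, proof of Lemma 2.1.1, `p = x^N`)

`Literature/RingTheory/PowerSeries/NthRootDenominatorType.lean`. Everything here is PROVED (no
definition, no named fact). In the proof of Lemma 2.1.1 of F. Calegari, V. Dimitrov, Y. Tang,
*The unbounded denominators conjecture* (J. Amer. Math. Soc. **38** (2025), 627–702;
arXiv:2109.09040), §2.1, the integrality condition `p(x(t)) ∈ ℤ⟦t⟧` for `x(t) ∈ t + t²ℚ⟦t⟧` is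
shown to entail `x(t) ∈ t + (t²/M) ℤ⟦t/M⟧`: "the binomial expansion gives
`(1+u)^{1/N} = ∑ binom(1/N, n) uⁿ ∈ ℤ⟦u/N²⟧`, by a simple denominator estimate. With our
assumptions … `y(t) … = tᴺ + c⁻¹tᴺ⁺¹ℤ⟦t⟧` and hence `ζ y(t)^{1/N} = t (1 + b₁t/c + b₂t²/c + ⋯)^{1/N}`
… the binomial expansion gives `ζ y(t)^{1/N} ∈ ℤ⟦t/(cN²)⟧` …". For `p(x) = xᴺ` (the case of the
unbounded denominators conjecture, where `y = xᴺ`, `c = 1` and Eisenstein's theorem is not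
needed) we prove exactly this: if `x ∈ t + t²ℚ⟦t⟧` and `x(t)ᴺ ∈ ℤ⟦t⟧`, then
`x(t) = M · w(t/M)` with `M = N²` and `w ∈ T + T²ℤ⟦T⟧` (`exists_denominatorType_of_pow_eq_map`),
the shape consumed by `Literature.RingTheory.PowerSeries.rescale_mem_range_of_subst_mem_range`.
Ingredients: uniqueness of `N`-th roots with constant term `1` in `ℚ⟦t⟧`
(`eq_of_pow_eq_of_constantCoeff_eq_one`), Mathlib's binomial series
(`PowerSeries.binomialSeries`, `(binomialSeries ℚ N⁻¹)ᴺ = 1 + X`), and the denominator estimate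
`binom(1/N, n) N²ⁿ ∈ ℤ` (`Literature.RingTheory.Binomial.binomialSeries_inv_rescale_mem_range`).

## References

* [CalegariDimitrovTang2025] F. Calegari, V. Dimitrov, Y. Tang, The unbounded denominators
  conjecture, J. Amer. Math. Soc. 38 (2025), no. 3, 627–702, §2.1, proof of Lemma 2.1.1 (second
  paragraph); arXiv:2109.09040.
-/

noncomputable section

open PowerSeries Finset

namespace Literature.RingTheory.PowerSeries

/-! ### 1. Generalities -/

section general

variable {R : Type*} [CommRing R]

/-- Substituting a series without constant term does not change the constant coefficient.
[folklore] -/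
theorem constantCoeff_subst_of_constantCoeff_eq_zero {a : PowerSeries R} (ha : constantCoeff a = 0)
    (f : PowerSeries R) : constantCoeff (f.subst a) = constantCoeff f := by
  rw [← coeff_zero_eq_constantCoeff_apply, ← coeff_zero_eq_constantCoeff_apply,
    coeff_subst' (HasSubst.of_constantCoeff_zero' ha), finsum_eq_single _ 0]
  · simp
  · intro d hd
    rw [coeff_zero_eq_constantCoeff_apply, map_pow, ha, zero_pow hd, smul_zero]

/-- Rescaling commutes into the substituend: `f(a)(rT) = f(a(rT))`. [folklore] -/
theorem rescale_subst_comm {K : Type*} [Field K] (r : K) {a : PowerSeries K}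
    (ha : constantCoeff a = 0) (f : PowerSeries K) :
    rescale r (f.subst a) = f.subst (rescale r a) := by
  have has : HasSubst a := HasSubst.of_constantCoeff_zero' ha
  have hra0 : constantCoeff (rescale r a) = 0 := by
    rw [← coeff_zero_eq_constantCoeff_apply, coeff_rescale, pow_zero, one_mul,
      coeff_zero_eq_constantCoeff_apply, ha]
  have hras : HasSubst (rescale r a) := HasSubst.of_constantCoeff_zero' hra0
  ext n
  rw [coeff_rescale, coeff_subst' has, coeff_subst' hras, mul_finsum]
  refine finsum_congr fun d ↦ ?_
  rw [← map_pow, coeff_rescale, smul_eq_mul, smul_eq_mul]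
  ring

/-- `g(T/r)(r W) = g(W)`. [folklore] -/
theorem rescale_inv_subst_smul {K : Type*} [Field K] {r : K} (hr : r ≠ 0) {W : PowerSeries K}
    (hW : constantCoeff W = 0) (g : PowerSeries K) :
    (rescale r⁻¹ g).subst (r • W) = g.subst W := by
  have hWs : HasSubst W := HasSubst.of_constantCoeff_zero' hW
  have hrWs : HasSubst (r • W) := hasSubst_smul hW r
  ext n
  rw [coeff_subst' hrWs, coeff_subst' hWs]
  refine finsum_congr fun d ↦ ?_
  rw [coeff_rescale, smul_pow, PowerSeries.coeff_smul, smul_eq_mul, smul_eq_mul, smul_eq_mul,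
    inv_pow]
  field_simp

/-- Powers of the binomial series: `B(r)ᵏ = B(k r)`. [folklore] -/
theorem binomialSeries_pow (r : ℚ) (k : ℕ) :
    (PowerSeries.binomialSeries ℚ r) ^ k = PowerSeries.binomialSeries ℚ ((k : ℚ) * r) := by
  induction k with
  | zero => simp
  | succ k ih => rw [pow_succ, ih, ← PowerSeries.binomialSeries_add, Nat.cast_succ, add_mul, one_mul]

/-- `(B(1/N))ᴺ = 1 + X`. [folklore] -/
theorem binomialSeries_inv_pow {N : ℕ} (hN : N ≠ 0) :
    (PowerSeries.binomialSeries ℚ ((N : ℚ)⁻¹)) ^ N = 1 + X := by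
  rw [binomialSeries_pow, mul_inv_cancel₀ (by exact_mod_cast hN : (N : ℚ) ≠ 0),
    show (1 : ℚ) = ((1 : ℕ) : ℚ) by norm_num, PowerSeries.binomialSeries_nat, pow_one]

/-- **Uniqueness of `N`-th roots with constant term `1`** in `K⟦t⟧`, `char K = 0`. [folklore] -/
theorem eq_of_pow_eq_of_constantCoeff_eq_one {K : Type*} [Field K] [CharZero K] {N : ℕ} (hN : N ≠ 0)
    {y y' : PowerSeries K} (hy : constantCoeff y = 1) (hy' : constantCoeff y' = 1)
    (h : y ^ N = y' ^ N) : y = y' := by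
  have hS := geom_sum₂_mul y y' N
  rw [h, sub_self] at hS
  have hS0 : (∑ i ∈ range N, y ^ i * y' ^ (N - 1 - i)) ≠ 0 := by
    intro h0
    have h1 := congrArg constantCoeff h0
    rw [map_sum, map_zero] at h1
    simp only [map_mul, map_pow, hy, hy', one_pow, mul_one, sum_const, card_range,
      nsmul_eq_mul] at h1
    exact hN (by exact_mod_cast h1)
  exact sub_eq_zero.mp ((mul_eq_zero.mp hS).resolve_left hS0)

end general

/-! ### 2. The denominator type of `x` from `xᴺ ∈ ℤ⟦t⟧` -/

/-- **`x ∈ t + t²ℚ⟦t⟧` with `x(t)ᴺ ∈ ℤ⟦t⟧` has denominator type `N²`**: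
`x(t) = N² · w(t/N²)` for some `w ∈ T + T²ℤ⟦T⟧` — i.e. `x(t) ∈ t + (t²/M)ℤ⟦t/M⟧`, `M = N²`
(CDT: "`(1+u)^{1/N} ∈ ℤ⟦u/N²⟧`, by a simple denominator estimate").
[cite: CalegariDimitrovTang2025, §2.1, proof of Lemma 2.1.1] -/
theorem exists_denominatorType_of_pow_eq_map {N : ℕ} (hN : 0 < N) {x : PowerSeries ℚ}
    (hx0 : constantCoeff x = 0) (hx1 : coeff 1 x = 1) {Gx : PowerSeries ℤ}
    (hGx : Gx.map (Int.castRingHom ℚ) = x ^ N) :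
    ∃ w : PowerSeries ℤ, constantCoeff w = 0 ∧ coeff 1 w = 1 ∧
      x = ((N ^ 2 : ℕ) : ℚ) • (PowerSeries.subst (((N ^ 2 : ℕ) : ℚ)⁻¹ • (X : PowerSeries ℚ))
        (PowerSeries.map (Int.castRingHom ℚ) w) : PowerSeries ℚ) := by
  have hN0 : N ≠ 0 := hN.ne'
  -- the denominator estimate for the binomial series (W23), before any abbreviation
  obtain ⟨gz, hgz⟩ := Literature.RingTheory.Binomial.binomialSeries_inv_rescale_mem_range hN0
  set M : ℚ := ((N ^ 2 : ℕ) : ℚ) with hM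
  have hMN : M = (N : ℚ) ^ 2 := by rw [hM]; push_cast; ring
  have hM0 : M ≠ 0 := by rw [hMN]; exact pow_ne_zero 2 (by exact_mod_cast hN0)
  set b : PowerSeries ℚ := PowerSeries.binomialSeries ℚ ((N : ℚ)⁻¹) with hb
  rw [← hMN] at hgz
  /- `x = t · y`, `y ∈ 1 + tℚ⟦t⟧` -/
  set y : PowerSeries ℚ := PowerSeries.mk fun n ↦ coeff (n + 1) x with hy
  have hxy : x = X * y := by
    have h := eq_X_mul_shift_add_const x
    rw [hx0, map_zero, add_zero] at h
    exact h
  have hy0 : constantCoeff y = 1 := by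
    rw [← coeff_zero_eq_constantCoeff_apply, hy, coeff_mk, zero_add, hx1]
  /- `yᴺ = 1 + U(t)` with `U ∈ tℤ⟦t⟧` -/
  set Hz : PowerSeries ℤ := PowerSeries.mk fun n ↦ coeff (n + N) Gx with hHz
  have hHzmap : Hz.map (Int.castRingHom ℚ) = y ^ N := by
    ext n
    rw [coeff_map, hHz, coeff_mk]
    have h := congrArg (coeff (n + N)) hGx
    rw [coeff_map, hxy, mul_pow, coeff_X_pow_mul] at h
    exact h
  have hHz0 : constantCoeff Hz = 1 := by
    have h := congrArg (coeff 0) hHzmap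
    rw [coeff_map, coeff_zero_eq_constantCoeff_apply, coeff_zero_eq_constantCoeff_apply, map_pow,
      hy0, one_pow, eq_intCast] at h
    exact_mod_cast h
  set U : PowerSeries ℤ := Hz - 1 with hU
  have hU0 : constantCoeff U = 0 := by rw [hU, map_sub, hHz0, map_one, sub_self]
  set V : PowerSeries ℚ := U.map (Int.castRingHom ℚ) with hV
  have hyN : y ^ N = 1 + V := by
    rw [hV, hU, map_sub, map_one, hHzmap, add_sub_cancel]
  have hV0 : constantCoeff V = 0 := by
    rw [hV, ← coeff_zero_eq_constantCoeff_apply, coeff_map, coeff_zero_eq_constantCoeff_apply, hU0,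
      map_zero]
  have hVs : HasSubst V := HasSubst.of_constantCoeff_zero' hV0
  /- the binomial `N`-th root `y' = B(1/N)(V)` equals `y` -/
  set y' : PowerSeries ℚ := b.subst V with hy'
  have hy'N : y' ^ N = 1 + V := by
    rw [hy', ← PowerSeries.subst_pow hVs, hb, binomialSeries_inv_pow hN0,
      ← PowerSeries.coe_substAlgHom hVs, map_add, map_one, PowerSeries.coe_substAlgHom,
      PowerSeries.subst_X hVs]
  have hy'0 : constantCoeff y' = 1 := by
    rw [hy', constantCoeff_subst_of_constantCoeff_eq_zero hV0, hb,
      PowerSeries.binomialSeries_constantCoeff]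
  have hyy' : y = y' :=
    eq_of_pow_eq_of_constantCoeff_eq_one hN0 hy0 hy'0 (by rw [hyN, hy'N])
  /- denominators: `y(M t) = gz(Ũ(t))` with `gz, Ũ ∈ ℤ⟦t⟧`, `M = N²` -/
  set Ut : PowerSeries ℤ := PowerSeries.mk fun n ↦ ((N ^ 2 : ℕ) : ℤ) ^ (n - 1) * coeff n U
    with hUt
  have hUt0 : constantCoeff Ut = 0 := by
    rw [← coeff_zero_eq_constantCoeff_apply, hUt, coeff_mk, coeff_zero_eq_constantCoeff_apply, hU0,
      mul_zero]
  have hUts : HasSubst Ut := HasSubst.of_constantCoeff_zero' hUt0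
  have hUtQ0 : constantCoeff (Ut.map (Int.castRingHom ℚ)) = 0 := by
    rw [← coeff_zero_eq_constantCoeff_apply, coeff_map, coeff_zero_eq_constantCoeff_apply, hUt0,
      map_zero]
  -- `V(M t) = M · Ũ(t)`
  have hF1 : rescale M V = M • Ut.map (Int.castRingHom ℚ) := by
    ext n
    simp only [coeff_rescale, PowerSeries.coeff_smul, coeff_map, hUt, coeff_mk, hV, smul_eq_mul,
      eq_intCast, Int.cast_mul, Int.cast_pow, Int.cast_natCast]
    rcases Nat.eq_zero_or_pos n with hn | hn
    · subst hn
      rw [coeff_zero_eq_constantCoeff_apply, hU0]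
      simp
    · obtain ⟨k, rfl⟩ : ∃ k, n = k + 1 := ⟨n - 1, by omega⟩
      rw [Nat.add_sub_cancel, hM]
      push_cast
      ring
  -- `b = gz(t/M)`
  have hbg : b = rescale M⁻¹ (gz.map (Int.castRingHom ℚ)) := by
    rw [hgz, rescale_rescale, mul_inv_cancel₀ hM0, rescale_one, RingHom.id_apply]
  have hF3 : rescale M y' = PowerSeries.map (Int.castRingHom ℚ) (gz.subst Ut) := by
    rw [hy', rescale_subst_comm M hV0 b, hF1, hbg, rescale_inv_subst_smul hM0 hUtQ0,
      ← map_subst' hUts]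
  have hresc_y : rescale M y = PowerSeries.map (Int.castRingHom ℚ) (gz.subst Ut) := by
    rw [hyy', hF3]
  have hgz0 : constantCoeff gz = 1 := by
    have h := congrArg (coeff 0) hgz
    rw [coeff_map, coeff_rescale, pow_zero, one_mul, coeff_zero_eq_constantCoeff_apply,
      coeff_zero_eq_constantCoeff_apply, PowerSeries.binomialSeries_constantCoeff, eq_intCast] at h
    exact_mod_cast h
  /- the series `w = T · gz(Ũ(T))` -/
  refine ⟨X * gz.subst Ut, ?_, ?_, ?_⟩
  · rw [map_mul, constantCoeff_X, zero_mul]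
  · rw [show (1 : ℕ) = 0 + 1 from rfl, coeff_succ_X_mul, coeff_zero_eq_constantCoeff_apply,
      constantCoeff_subst_of_constantCoeff_eq_zero hUt0, hgz0]
  · rw [← rescale_eq_subst, map_mul, map_X, map_mul (rescale M⁻¹), rescale_X, ← hresc_y,
      rescale_rescale, mul_inv_cancel₀ hM0, rescale_one, RingHom.id_apply, hxy, smul_eq_C_mul,
      ← mul_assoc, ← mul_assoc, ← map_mul, mul_inv_cancel₀ hM0, map_one, one_mul]

end Literature.RingTheory.PowerSeries
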